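import Summits.KontsevichZagierPeriods.Zeta5Search.Barrier.ConeGammaCuspPeriodCanonical

/-!
# ζ(5) search — BARRIER: THE CANONICAL PATTERN FUNCTION — ascent cones and the covering schema with no structural hypothesis; the lattice junction

HONEST FRAMING (cell `pub-zeta5`): systematic search; no irrationality claim unless kernel-certified. MODEL objects
under Brown–Zudilin's (28)+(30) accounting ([BZ22] = arXiv:2210.03391; (28) observed, not proved); nothing here is a
statement about `ζ(5)`, any `γ` of record, the cone's supremum (C2 OPEN) or the value / sign of the cusp slope at a named
direction; NO certificate instance is asserted (at record/41, flag/60, argmax-120, t*/480 ascent directions exist — DATA);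
S-E stays CONJECTURED; records in print UNMOVED. Prover P2 g33, item «THE CANONICAL PATTERN FUNCTION», file (4)
(theorems only): the remaining two certificates of P2 g32's file (3) in the unconditional canonical form, and two remarks
on the canonical junction pattern function.

* **`cuspSlope_pos_on_cone_of_generators_canonical`** — the ASCENT-CONE certificate: with the canonical period pattern
  function `F = Σ_m patternN a b_m` and the junction counts `J_{kl}`, finitely many checks
  `Σ_k W_k(δ₀) r_k(g_j) − Σ_{ρ₀k<ρ₀l} J_{kl}(r_k(g_j) − r_l(g_j))⁺ > 0` at generators give `σ > 0` on their cone minus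
  its apex (hypotheses hpos / hT / hper / hgen / hF only);
* **`cuspSlope_nonpos_of_cone_covering_canonical`** — the COVERING SCHEMA: certified no-ascent cones (junction-count
  majorant `≤ 0` at the generators) covering the displacements give `σ ≤ 0` in EVERY direction — no `f`, `M`, `Λ` or
  spread hypothesis left; a finite index makes it a finite rational certificate (none is instanced here);
* `torusN_orbit_right_eq_patternN_univ`, `torusN_orbit_left_eq_patternN_empty` — the two extreme patterns are the
  orbit values just right / just left of the junction: `𝒩(θ_b + t·s(a)) = patternN a b univ`,
  `𝒩(θ_b − t·s(a)) = patternN a b ∅` for a small line step `t > 0`;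
* `patternN_zero_eq` — at the lattice point `b = 0` (all 28 forms are members, all floors `0`) the canonical pattern
  function is ONE set function, the same at every direction: `patternN a 0 A = patternN a' 0 A`.
NOT here: any certificate or value at a named direction; the covering computation; `γ`, C2, S-E, `ζ(5)`.
-/

noncomputable section

open Set MeasureTheory Finset
open scoped Topology

namespace Summit.KontsevichZagierPeriods.Zeta5Search.Barrier.ConeGamma

/-! ### The ascent-cone certificate and the covering schema, canonical form -/

open scoped Classical in
/-- **THE ASCENT-CONE CERTIFICATE — NO STRUCTURAL HYPOTHESIS.** All 28 forms of `a` positive, `T > 0` a period, `F` the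
canonical period pattern function, `δ₀` a generic reference, `g_j` (`j ∈ s`) generators at each of which the junction-count
MINORANT is positive: `0 < Σ_k W_k(δ₀)·r_k(g_j) − Σ_{ρ_k<ρ_l} J_{kl}·max(r_k(g_j) − r_l(g_j), 0)`. Then
`0 < cuspSlope a T (Σ_{j∈s} t_j • g_j)` for every `t ≥ 0` with some `t_j > 0` — ascent throughout the cone minus its apex. -/
theorem cuspSlope_pos_on_cone_of_generators_canonical {a : Dir} (hpos : ∀ k, 0 < h28 a k) {T : ℝ} (hT : 0 < T)
    (hper : ∀ k : Fin 28, ∃ z : ℤ, T * h28 a k = z) {F : Finset (Fin 28) → ℝ}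
    (hF : ∀ A, F A = ∑ m ∈ Finset.range ((bkpts a T).card - 1), ((patternN a (bkpt a T m) A : ℤ) : ℝ))
    {δ₀ : Fin 8 → ℝ} (hgen : ∀ k l : Fin 28, k ≠ l → phiForm δ₀ k / h28 a k ≠ phiForm δ₀ l / h28 a l)
    {ι : Type*} (s : Finset ι) (g : ι → Fin 8 → ℝ)
    (hcert : ∀ j ∈ s, 0 <
      ∑ k, (F (Finset.univ.filter fun l => phiForm δ₀ k / h28 a k ≤ phiForm δ₀ l / h28 a l) -
          F (Finset.univ.filter fun l => phiForm δ₀ k / h28 a k < phiForm δ₀ l / h28 a l)) *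
        (phiForm (g j) k / h28 a k) -
      ∑ k, ∑ l, (if phiForm δ₀ k / h28 a k < phiForm δ₀ l / h28 a l then
        ((((Finset.range ((bkpts a T).card - 1)).filter fun m =>
            (∃ z : ℤ, bkpt a T m * h28 a k = z) ∧ ∃ z : ℤ, bkpt a T m * h28 a l = z).card : ℕ) : ℝ) *
          max (phiForm (g j) k / h28 a k - phiForm (g j) l / h28 a l) 0 else 0))
    (t : ι → ℝ) (ht : ∀ j ∈ s, 0 ≤ t j) (htpos : ∃ j ∈ s, 0 < t j) :
    0 < cuspSlope a T (∑ j ∈ s, t j • g j) := by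
  classical
  exact cuspSlope_pos_on_cone_of_generators hpos hT hper
    (M := fun m => Finset.univ.filter fun k => ∃ z : ℤ, bkpt a T m * h28 a k = z)
    (f := fun m A => ((patternN a (bkpt a T m) A : ℤ) : ℝ)) (canonical_junction_agreement a T)
    (canonical_period_eq_sum_inter hF)
    (Λ := fun k l => ((((Finset.range ((bkpts a T).card - 1)).filter fun m =>
      (∃ z : ℤ, bkpt a T m * h28 a k = z) ∧ ∃ z : ℤ, bkpt a T m * h28 a l = z).card : ℕ) : ℝ))
    (fun _ _ => Nat.cast_nonneg _)
    (fun _ _ _ hkS _ hkl => (neg_abs_le _).trans' (neg_le_neg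
      (canonical_defect_abs_le_junctionCount hF hkS hkl)))
    hgen s g hcert t ht htpos

open scoped Classical in
/-- **THE CONE-COVERING CERTIFICATE — NO STRUCTURAL HYPOTHESIS.** All 28 forms of `a` positive, `T > 0` a period, `F`
the canonical period pattern function; a family of generic references `δ₀ c` with generator families `g c j` (`j ∈ s c`),
each certified by the junction-count majorant (`≤ 0` at every generator), whose cones COVER the displacements. Then
`cuspSlope a T δ ≤ 0` for EVERY `δ` — «no ascent direction anywhere» from finitely many rational checks on the cell's own
objects (a finite `κ`); no instance is asserted here. -/
theorem cuspSlope_nonpos_of_cone_covering_canonical {a : Dir} (hpos : ∀ k, 0 < h28 a k) {T : ℝ} (hT : 0 < T)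
    (hper : ∀ k : Fin 28, ∃ z : ℤ, T * h28 a k = z) {F : Finset (Fin 28) → ℝ}
    (hF : ∀ A, F A = ∑ m ∈ Finset.range ((bkpts a T).card - 1), ((patternN a (bkpt a T m) A : ℤ) : ℝ))
    {κ ι : Type*} (δ₀ : κ → Fin 8 → ℝ)
    (hgen : ∀ c, ∀ k l : Fin 28, k ≠ l → phiForm (δ₀ c) k / h28 a k ≠ phiForm (δ₀ c) l / h28 a l)
    (s : κ → Finset ι) (g : κ → ι → Fin 8 → ℝ)
    (hcert : ∀ c, ∀ j ∈ s c,
      ∑ k, (F (Finset.univ.filter fun l => phiForm (δ₀ c) k / h28 a k ≤ phiForm (δ₀ c) l / h28 a l) -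
          F (Finset.univ.filter fun l => phiForm (δ₀ c) k / h28 a k < phiForm (δ₀ c) l / h28 a l)) *
        (phiForm (g c j) k / h28 a k) +
      ∑ k, ∑ l, (if phiForm (δ₀ c) k / h28 a k < phiForm (δ₀ c) l / h28 a l then
        ((((Finset.range ((bkpts a T).card - 1)).filter fun m =>
            (∃ z : ℤ, bkpt a T m * h28 a k = z) ∧ ∃ z : ℤ, bkpt a T m * h28 a l = z).card : ℕ) : ℝ) *
          max (phiForm (g c j) k / h28 a k - phiForm (g c j) l / h28 a l) 0 else 0) ≤ 0)
    (hcover : ∀ δ : Fin 8 → ℝ, ∃ c, ∃ t : ι → ℝ, (∀ j ∈ s c, 0 ≤ t j) ∧ δ = ∑ j ∈ s c, t j • g c j)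
    (δ : Fin 8 → ℝ) : cuspSlope a T δ ≤ 0 := by
  classical
  exact cuspSlope_nonpos_of_cone_covering hpos hT hper
    (M := fun m => Finset.univ.filter fun k => ∃ z : ℤ, bkpt a T m * h28 a k = z)
    (f := fun m A => ((patternN a (bkpt a T m) A : ℤ) : ℝ)) (canonical_junction_agreement a T)
    (canonical_period_eq_sum_inter hF)
    (Λ := fun k l => ((((Finset.range ((bkpts a T).card - 1)).filter fun m =>
      (∃ z : ℤ, bkpt a T m * h28 a k = z) ∧ ∃ z : ℤ, bkpt a T m * h28 a l = z).card : ℕ) : ℝ))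
    (fun _ _ => Nat.cast_nonneg _)
    (fun _ _ _ hkS _ hkl => (le_abs_self _).trans (canonical_defect_abs_le_junctionCount hF hkS hkl))
    δ₀ hgen s g hcert hcover δ

/-! ### The two extreme patterns are the orbit values; the lattice junction is universal -/

/-- **All members up = just right of the junction**: for `b ∈ bkpts a T` and a line step `t > 0` below the walls
(`t·x_max < 1`, `t·x_max < wallDist a T`): `𝒩(θ_b + t·s(a)) = patternN a b univ`. -/
theorem torusN_orbit_right_eq_patternN_univ {a : Dir} (hpos : ∀ k, 0 < h28 a k) {T b : ℝ} (hb : b ∈ bkpts a T)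
    {t : ℝ} (ht : 0 < t) (ht1 : t * xMax a < 1) (ht2 : t * xMax a < wallDist a T) :
    torusN (b • sParam a + t • sParam a) = patternN a b Finset.univ := by
  classical
  have h1 : ∀ k, |phiForm (t • sParam a) k| < 1 := fun k => (phiForm_line_step_small hpos ht ht1 k).2.2.2.1
  have h2 : ∀ k, |phiForm (t • sParam a) k| < wallDist a T := fun k =>
    (phiForm_line_step_small hpos ht ht2 k).2.2.2.1
  rw [torusN_bkpt_add_eq_patternN hb h1 h2 (M := Finset.univ) (fun k _ => Finset.mem_univ k)]
  congr 1
  refine Finset.filter_true_of_mem fun k _ => ?_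
  rw [phiForm_smul_sParam]
  exact (mul_pos ht (hpos k)).le

/-- **All members down = just left of the junction**: `𝒩(θ_b − t·s(a)) = patternN a b ∅` for the same line steps. -/
theorem torusN_orbit_left_eq_patternN_empty {a : Dir} (hpos : ∀ k, 0 < h28 a k) {T b : ℝ} (hb : b ∈ bkpts a T)
    {t : ℝ} (ht : 0 < t) (ht1 : t * xMax a < 1) (ht2 : t * xMax a < wallDist a T) :
    torusN (b • sParam a - t • sParam a) = patternN a b ∅ := by
  classical
  have e : b • sParam a - t • sParam a = b • sParam a + (-t) • sParam a := by
    rw [sub_eq_add_neg, neg_smul]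
  have h1 : ∀ k, |phiForm ((-t) • sParam a) k| < 1 := fun k => (phiForm_line_step_small hpos ht ht1 k).2.2.2.2
  have h2 : ∀ k, |phiForm ((-t) • sParam a) k| < wallDist a T := fun k =>
    (phiForm_line_step_small hpos ht ht2 k).2.2.2.2
  rw [e, torusN_bkpt_add_eq_patternN hb h1 h2 (M := Finset.univ) (fun k _ => Finset.mem_univ k)]
  congr 1
  refine Finset.filter_false_of_mem fun k _ => ?_
  rw [(phiForm_line_step_small hpos ht ht1 k).2.1, not_le, neg_lt_zero]
  exact mul_pos ht (hpos k)

/-- **THE LATTICE JUNCTION IS UNIVERSAL**: at `b = 0` (the lattice point `θ = 0`, where all 28 forms are members and all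
floors vanish) the canonical pattern function is the same set function at every direction:
`patternN a 0 A = patternN a' 0 A` (namely `floorN (−[k ∉ A])_k`). -/
theorem patternN_zero_eq (a a' : Dir) (A : Finset (Fin 28)) : patternN a 0 A = patternN a' 0 A := by
  classical
  unfold patternN
  congr 1
  funext k
  simp only [zero_mul, Int.floor_zero]

end Summit.KontsevichZagierPeriods.Zeta5Search.Barrier.ConeGamma

end
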